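import Summits.Parity.GeneralizedHardyLittlewood.Theorems.ParityLeakOneFifthPlainSplitRoughLiouvilleTwistedSmall
import HarnessLib

/-!
# Route ParityLeakOneFifth, crux `ParityLeakSieve` (stmt-Parity-18381), skeleton `birth`:
# stub S3 `stub_calibrationLowerBound` (the calibration lower bound, constant uniform in `ε`)

`Π(ε, x) = Σ_{x<n≤2x} b(n) λ(n+2) Φ(n+2) ≥ x/(100 log x)` for all `0 < ε ≤ ε₃` and `x ≥ x₀(ε)`, with the
constant `c₀ = 1/100` INDEPENDENT of `ε` (the registered stub quantifies `∃ c₀ ∃ ε₃ ∀ ε ≤ ε₃`).  This is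
the calibration lower bound of the sister crux `PlainSplit` (stmt-Parity-18382, line `calib-split`,
`calibrationLowerBound_of_twisted` + `stub_roughLiouvilleTwistedSmall`, both landed), whose landed
statement hides the constant behind `ε` (`∀ ε ≤ ε₁, ∃ c₀ > 0`); the proof below is the same assembly
(`calib_arith2` over the four twisted stubs, the growth bound `200 x^{4/5} ≤ V x/(100 log x)`), with the
quantifiers in the order the skeleton `birth` consumes.
-/

namespace Summit.Parity.GeneralizedHardyLittlewood.Theorems.ParityLeakOneFifth

open Finset

/-- The calibration lower bound with the explicit constant `1/100`, parametrised by the route's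
dictionary (`z, V, b, Φ` supplied as equations): for `0 < ε ≤ ε₁` and `x ≥ x₀(ε)`,
`x/(100 log x) ≤ Σ_{x<n≤2x} b(n) λ(n+2) Φ(n+2)`. Same proof as `calibrationLowerBound_of_twisted`
(crux `PlainSplit`), with `stub_roughLiouvilleTwistedSmall` plugged in. -/
theorem calibrationLowerBound_param :
    ∃ ε₁ : ℝ, 0 < ε₁ ∧ ∀ ε : ℝ, 0 < ε → ε ≤ ε₁ → ∃ x₀ : ℕ, ∀ x : ℕ, x₀ ≤ x → ∀ (z V : ℝ) (b Φ : ℕ → ℝ), z = Real.exp (Real.log (Real.log (x : ℝ)) ^ 2) → V = ∏ p ∈ (Finset.range ⌈z⌉₊).filter Nat.Prime, (1 - 1 / (p : ℝ)) → b = (fun n : ℕ => if ∀ p ∈ n.primeFactors, z ≤ (p : ℝ) then 1 / V else 0) → Φ = (fun m : ℕ => if (x : ℝ) ^ (ε ^ 2) ≤ (m.minFac : ℝ) ∧ (m.minFac : ℝ) < (x : ℝ) ^ ((1 : ℝ) / 5) then ∑ d ∈ (Nat.divisors m).filter (fun d : ℕ => (d : ℝ) ≤ (x : ℝ) ^ ((1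 : ℝ) / 2 - 2 * ε) ∧ ∀ p ∈ d.primeFactors, (x : ℝ) ^ ((1 : ℝ) / 5) ≤ (p : ℝ)), (ArithmeticFunction.moebius d : ℝ) else 0) → 1 / 100 * (x : ℝ) / Real.log (x : ℝ) ≤ ∑ n ∈ Finset.Ioc x (2 * x), b n * (ArithmeticFunction.liouville (n + 2) : ℝ) * Φ (n + 2) := by
  have hA := stub_roughLiouvilleTwistedSmall
  have hR := stub_calibReduction
  have hP := stub_twistedPrimesLower
  have hE := stub_twistedE3Upper
  have hB := stub_twistedBoundaryUpper
  obtain ⟨C, hC, ε₀, hε₀, hB⟩ := hB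
  obtain ⟨ε₀', hε₀', hA⟩ := hA (1 / 100) (by norm_num)
  obtain ⟨c, hc, hVlow⟩ :=
    Literature.NumberTheory.Sieve.IntervalClassSieve.le_prod_one_sub_card_div 1
  refine ⟨min (min ε₀ ε₀') (min (1 / (50 * C)) (1 / 25)), by positivity, ?_⟩
  intro ε hε hεle
  have hεε₀ : ε ≤ ε₀ := hεle.trans ((min_le_left _ _).trans (min_le_left _ _))
  have hεε₀' : ε ≤ ε₀' := hεle.trans ((min_le_left _ _).trans (min_le_right _ _))
  have hεC : ε ≤ 1 / (50 * C) := hεle.trans ((min_le_right _ _).trans (min_le_left _ _))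
  have hε25 : ε ≤ 1 / 25 := hεle.trans ((min_le_right _ _).trans (min_le_right _ _))
  have hCε : C * ε ≤ 1 / 50 := by
    calc C * ε ≤ C * (1 / (50 * C)) := mul_le_mul_of_nonneg_left hεC hC.le
      _ = 1 / 50 := by field_simp
  obtain ⟨x₁, hx₁⟩ := hR ε hε hε25
  obtain ⟨x₂, hx₂⟩ := hP (1 / 100) (by norm_num)
  obtain ⟨x₃, hx₃⟩ := hE (1 / 100) (by norm_num)
  obtain ⟨x₄, hx₄⟩ := hB ε hε hεε₀
  obtain ⟨x₅, hx₅⟩ := hA ε hε hεε₀'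
  -- growth: `200 x^{4/5} ≤ (1/100) V x / log x`
  obtain ⟨T, hT1, hT⟩ := exists_quadratic_le_exp 0 25 (5 * Real.log (20000 / c))
  obtain ⟨x₆, hx₆⟩ := exists_nat_loglog_ge T
  refine ⟨max (max (max x₁ x₂) (max x₃ x₄)) (max x₅ x₆), ?_⟩
  intro x hx
  rintro z V b Φ rfl rfl rfl rfl
  simp only [max_le_iff] at hx
  obtain ⟨⟨⟨hx1, hx2⟩, hx3, hx4⟩, hx5, hx6⟩ := hx
  obtain ⟨hxE, hlogx, hTt⟩ := hx₆ x hx6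
  -- the parameters
  set t : ℝ := Real.log (Real.log (x : ℝ)) with ht
  have ht1 : 1 ≤ t := hT1.trans hTt
  have ht0 : 0 ≤ t := by linarith
  have hx0 : (0 : ℝ) < x := (Real.exp_pos _).trans_le hxE
  have hlogpos : 0 < Real.log (x : ℝ) := (Real.exp_pos _).trans_le hlogx
  have hexpt : Real.exp t = Real.log (x : ℝ) := by rw [ht, Real.exp_log hlogpos]
  have hxexp : Real.exp (Real.exp t) = (x : ℝ) := by rw [hexpt, Real.exp_log hx0]
  set z : ℝ := Real.exp (t ^ 2) with hz
  have hz2 : 2 < z := by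
    have h1 : Real.exp 1 ≤ z := Real.exp_le_exp.2 (by nlinarith)
    have h2 : (2 : ℝ) < Real.exp 1 := by have := Real.exp_one_gt_d9; linarith
    linarith
  have hlogz : Real.log z = t ^ 2 := by rw [hz, Real.log_exp]
  set V : ℝ := ∏ p ∈ (Finset.range ⌈z⌉₊).filter Nat.Prime, (1 - 1 / (p : ℝ)) with hV
  set Vsh : ℝ := ∏ p ∈ (Finset.range ⌈z⌉₊).filter (fun p : ℕ => p.Prime ∧ p ≠ 2),
    (1 - 1 / ((p : ℝ) - 1)) with hVsh
  -- `V ≥ c / t⁴ > 0` and `V ≤ Vsh`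
  have hVc : c / t ^ 4 ≤ V := by
    have hPB : Nat.primesBelow ⌈z⌉₊ = (Finset.range ⌈z⌉₊).filter Nat.Prime := rfl
    have h := hVlow (fun p => {(p - x % p) % p}) (fun p _ => by rw [Finset.card_singleton])
      (fun p hp => by rw [Finset.card_singleton]; exact hp.one_lt) z hz2.le
    rw [hPB, hlogz] at h
    have e : (t ^ 2) ^ (2 * 1) = t ^ 4 := by ring
    rw [e] at h
    refine h.trans (le_of_eq (Finset.prod_congr rfl fun p _ => ?_))
    rw [Finset.card_singleton, Nat.cast_one]
  have ht4 : 0 < t ^ 4 := by positivity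
  have hV0 : 0 < V := lt_of_lt_of_le (div_pos hc ht4) hVc
  have hVVsh : V ≤ Vsh := V_le_Vsh hz2
  -- instantiate the stubs
  set G : ℕ → ℝ := fun m : ℕ => ∑ d ∈ (Nat.divisors m).filter (fun d : ℕ =>
    (d : ℝ) ≤ (x : ℝ) ^ ((1 : ℝ) / 2 - 2 * ε) ∧ ∀ p ∈ d.primeFactors,
      (x : ℝ) ^ ((1 : ℝ) / 5) ≤ (p : ℝ)), (ArithmeticFunction.moebius d : ℝ) with hG
  set ΦL : ℕ → ℝ := fun m : ℕ => if (x : ℝ) ^ (ε ^ 2) ≤ (m.minFac : ℝ) ∧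
      (m.minFac : ℝ) < (x : ℝ) ^ ((1 : ℝ) / 5) then ∑ d ∈ (Nat.divisors m).filter (fun d : ℕ =>
        (d : ℝ) ≤ (x : ℝ) ^ ((1 : ℝ) / 2 - 2 * ε) ∧ ∀ p ∈ d.primeFactors,
          (x : ℝ) ^ ((1 : ℝ) / 5) ≤ (p : ℝ)), (ArithmeticFunction.moebius d : ℝ) else 0 with hΦL
  have hΦG : ΦL = fun m : ℕ => if (x : ℝ) ^ (ε ^ 2) ≤ (m.minFac : ℝ) ∧
      (m.minFac : ℝ) < (x : ℝ) ^ ((1 : ℝ) / 5) then G m else 0 := by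
    funext m; rfl
  set bL : ℕ → ℝ := fun n : ℕ => if ∀ p ∈ n.primeFactors, z ≤ (p : ℝ) then 1 / V else 0 with hbL
  have hR' := hx₁ x hx1 z G ΦL rfl rfl hΦG
  have hP' := hx₂ x hx2 z Vsh rfl rfl
  have hE' := hx₃ x hx3 z Vsh rfl rfl
  have hB' := hx₄ x hx4 z Vsh rfl rfl
  have hA' := abs_le.1 (hx₅ x hx5 z V G rfl rfl rfl)
  -- growth: `200 x^{4/5} ≤ (1/100) V x / log x`
  have hgrowth : 200 * (x : ℝ) ^ ((4 : ℝ) / 5) ≤ 1 / 100 * V * (x : ℝ) / Real.log (x : ℝ) := by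
    have hx45 : (x : ℝ) ^ ((4 : ℝ) / 5) = Real.exp (4 / 5 * Real.exp t) := by
      rw [← hxexp, ← Real.exp_mul]; ring_nf
    have h1 : t ^ 4 ≤ Real.exp (4 * t) := by
      have h := Real.add_one_le_exp t
      have h' : t ≤ Real.exp t := by linarith
      calc t ^ 4 ≤ (Real.exp t) ^ 4 := pow_le_pow_left₀ ht0 h' 4
        _ = Real.exp (4 * t) := by rw [← Real.exp_nat_mul]; norm_num
    have h2 := hT t hTt
    have hc48 : 0 < 20000 / c := by positivity
    have key : 20000 * t ^ 4 * Real.exp t ≤ c * Real.exp (Real.exp t / 5) := by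
      have h3 : Real.exp (Real.log (20000 / c) + 5 * t) ≤ Real.exp (Real.exp t / 5) :=
        Real.exp_le_exp.2 (by linarith)
      rw [Real.exp_add, Real.exp_log hc48] at h3
      have h4 : 20000 * t ^ 4 * Real.exp t ≤ 20000 * Real.exp (5 * t) := by
        have : t ^ 4 * Real.exp t ≤ Real.exp (4 * t) * Real.exp t :=
          mul_le_mul_of_nonneg_right h1 (Real.exp_pos t).le
        rw [← Real.exp_add, show 4 * t + t = 5 * t by ring] at this
        linarith
      have h5 : 20000 * Real.exp (5 * t) = c * (20000 / c * Real.exp (5 * t)) := by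
        field_simp
      rw [h5] at h4
      exact h4.trans (mul_le_mul_of_nonneg_left h3 hc.le)
    have hL : Real.log (x : ℝ) = Real.exp t := hexpt.symm
    rw [hx45, hL, ← hxexp]
    have hVx : 1 / 100 * (c / t ^ 4) * Real.exp (Real.exp t) / Real.exp t ≤
        1 / 100 * V * Real.exp (Real.exp t) / Real.exp t := by
      have := mul_le_mul_of_nonneg_right hVc
        (by positivity : (0 : ℝ) ≤ 1 / 100 * Real.exp (Real.exp t) / Real.exp t)
      calc 1 / 100 * (c / t ^ 4) * Real.exp (Real.exp t) / Real.exp t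
          = c / t ^ 4 * (1 / 100 * Real.exp (Real.exp t) / Real.exp t) := by ring
        _ ≤ V * (1 / 100 * Real.exp (Real.exp t) / Real.exp t) := this
        _ = 1 / 100 * V * Real.exp (Real.exp t) / Real.exp t := by ring
    refine le_trans ?_ hVx
    rw [le_div_iff₀ (Real.exp_pos t)]
    have hsplitexp : Real.exp (Real.exp t) =
        Real.exp (Real.exp t / 5) * Real.exp (4 / 5 * Real.exp t) := by
      rw [← Real.exp_add]; ring_nf
    rw [hsplitexp]
    have hpos : 0 < Real.exp (4 / 5 * Real.exp t) := Real.exp_pos _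
    have key' : 200 * Real.exp t ≤ 1 / 100 * (c / t ^ 4) * Real.exp (Real.exp t / 5) := by
      rw [show 1 / 100 * (c / t ^ 4) * Real.exp (Real.exp t / 5) =
        (c * Real.exp (Real.exp t / 5)) / (100 * t ^ 4) by field_simp]
      rw [le_div_iff₀ (by positivity)]
      nlinarith [key]
    have hfin := mul_le_mul_of_nonneg_right key' hpos.le
    calc 200 * Real.exp (4 / 5 * Real.exp t) * Real.exp t
        = 200 * Real.exp t * Real.exp (4 / 5 * Real.exp t) := by ring
      _ ≤ 1 / 100 * (c / t ^ 4) * Real.exp (Real.exp t / 5) * Real.exp (4 / 5 * Real.exp t) := hfin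
      _ = 1 / 100 * (c / t ^ 4) * (Real.exp (Real.exp t / 5) * Real.exp (4 / 5 * Real.exp t)) := by
          ring
  -- the model sum is `(1/V)·Σ_{rough} λ Φ`
  have hgoal : ∑ n ∈ Finset.Ioc x (2 * x), bL n * (ArithmeticFunction.liouville (n + 2) : ℝ) *
      ΦL (n + 2) = 1 / V * ∑ n ∈ (Finset.Ioc x (2 * x)).filter
        (fun n : ℕ => ∀ p ∈ n.primeFactors, z ≤ (p : ℝ)),
          (ArithmeticFunction.liouville (n + 2) : ℝ) * ΦL (n + 2) := by
    simp only [hbL]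
    exact sum_model_mul_eq x z V ΦL
  rw [hgoal]
  set S : ℝ := ∑ n ∈ (Finset.Ioc x (2 * x)).filter (fun n : ℕ => ∀ p ∈ n.primeFactors, z ≤ (p : ℝ)),
    (ArithmeticFunction.liouville (n + 2) : ℝ) * ΦL (n + 2) with hSdef
  have hVne : V ≠ 0 := hV0.ne'
  have hVinv : 0 ≤ 1 / V := (one_div_pos.2 hV0).le
  suffices key : 1 / 100 * (x : ℝ) / Real.log (x : ℝ) * V ≤ S by
    calc 1 / 100 * (x : ℝ) / Real.log (x : ℝ)
        = (1 / 100 * (x : ℝ) / Real.log (x : ℝ) * V) * (1 / V) := by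
          rw [one_div V, mul_inv_cancel_right₀ hVne]
      _ ≤ S * (1 / V) := mul_le_mul_of_nonneg_right key hVinv
      _ = 1 / V * S := by ring
  -- assemble the inequalities
  exact calib_arith2 hR' hP' hE' hB' hA'.1 hgrowth hCε hVVsh hx0 hlogpos hV0.le


/-- **Stub S3 `stub_calibrationLowerBound`** of skeleton `birth` (crux `ParityLeakSieve`,
stmt-Parity-18381), verbatim: there are `c₀ > 0` (`= 1/100`) and `ε₃ > 0` such that for
`0 < ε ≤ ε₃` and `x ≥ x₀(ε)`, `c₀ x/log x ≤ Π(ε, x) = Σ_{x<n≤2x} b(n) λ(n+2) Φ(n+2)`. -/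
theorem stub_calibrationLowerBound : ∃ c₀ : ℝ, 0 < c₀ ∧ ∃ ε₃ : ℝ, 0 < ε₃ ∧ ∀ ε : ℝ, 0 < ε → ε ≤ ε₃ → ∃ x₀ : ℕ, ∀ x : ℕ, x₀ ≤ x → (fun (b Φ : ℕ → ℝ) => c₀ * (x : ℝ) / Real.log (x : ℝ) ≤ (∑ n ∈ Finset.Ioc x (2 * x), b n * (ArithmeticFunction.liouville (n + 2) : ℝ) * Φ (n + 2))) (fun n : ℕ => if ∀ p ∈ n.primeFactors, Real.exp (Real.log (Real.log (x : ℝ)) ^ 2) ≤ (p : ℝ) then 1 / (∏ p ∈ (Finset.range ⌈Real.exp (Real.log (Real.log (x : ℝ)) ^ 2)⌉₊).filter Nat.Prime, (1 - 1 / (p : ℝ))) else 0) (fun m : ℕ => if (x : ℝ) ^ (ε ^ 2) ≤ (m.minFac : ℝ) ∧ (m.minFac : ℝ) < (x : ℝ) ^ ((1 : ℝ) / 5) then ∑ d ∈ (Nat.divisors m).filter (fun d : ℕ => (d : ℝ) ≤ (x : ℝ) ^ ((1 : ℝ) / 2 - 2 * ε) ∧ ∀ p ∈ d.primeFactors, (x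 : ℝ) ^ ((1 : ℝ) / 5) ≤ (p : ℝ)), (ArithmeticFunction.moebius d : ℝ) else 0) := by
  obtain ⟨ε₁, hε₁, h⟩ := calibrationLowerBound_param
  refine ⟨1 / 100, by norm_num, ε₁, hε₁, fun ε hε hεle => ?_⟩
  obtain ⟨x₀, hx₀⟩ := h ε hε hεle
  refine ⟨x₀, fun x hx => ?_⟩
  beta_reduce
  exact hx₀ x hx _ _ _ _ rfl rfl rfl rfl

end Summit.Parity.GeneralizedHardyLittlewood.Theorems.ParityLeakOneFifth
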